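import Summits.NavierStokesRegularity.NavierStokesRegularity.Theses.AxisymmetricExtremality
import Literature.Algebra.EuclideanLattices.FccBccLattices

/-!
# `MinimalDatumPFold` (crux stmt-NavierStokesRegularity-15452, route AxisymmetricExtremality) —
# the natural ABSTRACT strengthening is false (cdisprove seat, cycle 1, `Negative/` lane)

Line `birth` of the crux obtains `p`-fold symmetric Rusin–Šverák minimal blow-up data as Smith fixed
points of `Z_p ⊂ SO(2)` acting on the compact moduli space `M̂ = M/Sim`; line `symmetric-gap` asks
for the infimum form `ρ_p = ρ_max`. Everything the tree PROVES about `M` abstractly is: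
non-emptiness and compactness modulo `Sim` (Rusin–Šverák Cor. 4.3, `rusin_sverak_minimal_blowup_holds`,
`rusin_sverak_minimal_data_compact_holds`), closedness of the blow-up set (stability), invariance
under rotations, and — granting robustness of blow-up under far-field superposition — symmetric
blow-up data for every `p` (`ρ_p < ∞`). THIS FILE SHOWS THAT THESE ABSTRACT PROPERTIES DO NOT IMPLY
THE CRUX (`not_abstractExtremality`): in `EuclideanSpace ℝ (Fin 3)`, with the route's own rotations `R_θ` about the
`x₂`-axis written out verbatim, the closed rotation-invariant "bad" set
`{x : EuclideanSpace ℝ (Fin 3) | 1 ≤ x 0 ^ 2 + x 1 ^ 2 ∨ 2 ≤ x 2} = {1 ≤ x₀² + x₁²} ∪ {2 ≤ x₂}` has the horizontal unit circle as its (non-empty, compact) set of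
norm-minimisers — a FREE `SO(2)`-orbit, Euler characteristic `0`, not `F_p`-acyclic: exactly the
route's "why it might fail" scenario — and `R_{2π/p}`-fixed bad elements for every `p` (the axis
points, norm `≥ 2`), but NO `R_{2π/p}`-fixed minimiser for any `p ≥ 2`; indeed the symmetric
threshold is `2 > 1` (`toy_symmetric_gap`, the abstract shadow of `stub_symmGapClosing`). Hence any
proof of the crux must use a genuinely additional input: `F_p`-acyclicity of `M̂` (no source) or an
ANALYTIC gap-closing mechanism `ρ_p = ρ_max` specific to Navier–Stokes. No new definitions and no notations: the sets and points are written out.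

## References

* W. Rusin, V. Šverák, J. Funct. Anal. 260 (2011) 879–891 = arXiv:0911.0500, Cor. 4.3. [RusinSverak2011]
* C. Allday, V. Puppe, Cohomological methods in transformation groups (1993), Cor. 1.4.7, Thm. 3.1.10. [AlldayPuppe1993]
-/

set_option linter.dupNamespace false

noncomputable section

open Set Topology

namespace Summit.NavierStokesRegularity.NavierStokesRegularity.Theorems.MinimalDatumPFold.Negative

/-- The bad set is invariant under every rotation about the `x₂`-axis (`cos² + sin² = 1`). -/
theorem toyBad_rot (θ : ℝ) (x : EuclideanSpace ℝ (Fin 3)) (hx : x ∈ {x : EuclideanSpace ℝ (Fin 3) | 1 ≤ x 0 ^ 2 + x 1 ^ 2 ∨ 2 ≤ x 2}) :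
    (WithLp.toLp 2 ![Real.cos θ * x 0 - Real.sin θ * x 1, Real.sin θ * x 0 + Real.cos θ * x 1, x 2] : EuclideanSpace ℝ (Fin 3)) ∈ {x : EuclideanSpace ℝ (Fin 3) | 1 ≤ x 0 ^ 2 + x 1 ^ 2 ∨ 2 ≤ x 2} := by
  simp only [mem_setOf_eq] at hx ⊢
  rcases hx with h | h
  · left
    have key : (Real.cos θ * x 0 - Real.sin θ * x 1) ^ 2 + (Real.sin θ * x 0 + Real.cos θ * x 1) ^ 2 =
        x 0 ^ 2 + x 1 ^ 2 := by
      linear_combination (x 0 ^ 2 + x 1 ^ 2) * Real.sin_sq_add_cos_sq θ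
    simpa [key] using h
  · right
    simpa using h

/-- The bad set is closed. -/
theorem isClosed_toyBad : IsClosed {x : EuclideanSpace ℝ (Fin 3) | 1 ≤ x 0 ^ 2 + x 1 ^ 2 ∨ 2 ≤ x 2} := by
  have hc : ∀ i : Fin 3, Continuous fun x : EuclideanSpace ℝ (Fin 3) => x i := fun i => (EuclideanSpace.proj i).continuous
  apply IsClosed.union
  · exact isClosed_le continuous_const (((hc 0).pow 2).add ((hc 1).pow 2))
  · exact isClosed_le continuous_const (hc 2)

/-- `‖(1,0,0)‖ = 1`. [folklore] -/
theorem toy_norm_e0 : ‖(WithLp.toLp 2 ![(1 : ℝ), 0, 0] : EuclideanSpace ℝ (Fin 3))‖ = 1 := by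
  have h : ‖(WithLp.toLp 2 ![(1 : ℝ), 0, 0] : EuclideanSpace ℝ (Fin 3))‖ ^ 2 = 1 := by
    rw [Literature.Algebra.EuclideanLattices.norm_sq_fin_three]
    simp
  exact (pow_eq_one_iff_of_nonneg (norm_nonneg _) two_ne_zero).1 h

/-- Every bad point has norm `≥ 1`. -/
theorem one_le_norm_of_toyBad {y : EuclideanSpace ℝ (Fin 3)} (hy : y ∈ {x : EuclideanSpace ℝ (Fin 3) | 1 ≤ x 0 ^ 2 + x 1 ^ 2 ∨ 2 ≤ x 2}) : 1 ≤ ‖y‖ := by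
  simp only [mem_setOf_eq] at hy
  rcases hy with h | h
  · have hsq : 1 ≤ ‖y‖ ^ 2 := by
      rw [Literature.Algebra.EuclideanLattices.norm_sq_fin_three]; nlinarith [sq_nonneg (y 2)]
    nlinarith [norm_nonneg y]
  · have h2 : |y 2| ≤ ‖y‖ := by
      have := PiLp.norm_apply_le y 2
      simpa using this
    have : (2 : ℝ) ≤ |y 2| := le_trans h (le_abs_self _)
    linarith

/-- `(1,0,0)` is a norm-minimiser: the minimiser set is non-empty (abstract `M ≠ ∅`). -/
theorem e0_mem_toyMin : (WithLp.toLp 2 ![(1 : ℝ), 0, 0] : EuclideanSpace ℝ (Fin 3)) ∈ {x : EuclideanSpace ℝ (Fin 3) | x ∈ {x : EuclideanSpace ℝ (Fin 3) | 1 ≤ x 0 ^ 2 + x 1 ^ 2 ∨ 2 ≤ x 2} ∧ ∀ y ∈ {x : EuclideanSpace ℝ (Fin 3) | 1 ≤ x 0 ^ 2 + x 1 ^ 2 ∨ 2 ≤ x 2}, ‖x‖ ≤ ‖y‖} := by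
  refine ⟨Or.inl (by simp), fun y hy => ?_⟩
  rw [toy_norm_e0]
  exact one_le_norm_of_toyBad hy

/-- The minimiser set is compact (abstract `M̂` compact). -/
theorem isCompact_toyMin : IsCompact {x : EuclideanSpace ℝ (Fin 3) | x ∈ {x : EuclideanSpace ℝ (Fin 3) | 1 ≤ x 0 ^ 2 + x 1 ^ 2 ∨ 2 ≤ x 2} ∧ ∀ y ∈ {x : EuclideanSpace ℝ (Fin 3) | 1 ≤ x 0 ^ 2 + x 1 ^ 2 ∨ 2 ≤ x 2}, ‖x‖ ≤ ‖y‖} := by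
  apply Metric.isCompact_of_isClosed_isBounded
  · have hset : {x : EuclideanSpace ℝ (Fin 3) | x ∈ {x : EuclideanSpace ℝ (Fin 3) | 1 ≤ x 0 ^ 2 + x 1 ^ 2 ∨ 2 ≤ x 2} ∧ ∀ y ∈ {x : EuclideanSpace ℝ (Fin 3) | 1 ≤ x 0 ^ 2 + x 1 ^ 2 ∨ 2 ≤ x 2}, ‖x‖ ≤ ‖y‖} = {x : EuclideanSpace ℝ (Fin 3) | 1 ≤ x 0 ^ 2 + x 1 ^ 2 ∨ 2 ≤ x 2} ∩ ⋂ y : EuclideanSpace ℝ (Fin 3), {x : EuclideanSpace ℝ (Fin 3) | y ∈ {x : EuclideanSpace ℝ (Fin 3) | 1 ≤ x 0 ^ 2 + x 1 ^ 2 ∨ 2 ≤ x 2} → ‖x‖ ≤ ‖y‖} := by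
      ext x
      simp only [mem_setOf_eq, mem_inter_iff, mem_iInter]
    rw [hset]
    refine isClosed_toyBad.inter (isClosed_iInter fun y => ?_)
    by_cases hy : y ∈ {x : EuclideanSpace ℝ (Fin 3) | 1 ≤ x 0 ^ 2 + x 1 ^ 2 ∨ 2 ≤ x 2}
    · have : {x : EuclideanSpace ℝ (Fin 3) | y ∈ {x : EuclideanSpace ℝ (Fin 3) | 1 ≤ x 0 ^ 2 + x 1 ^ 2 ∨ 2 ≤ x 2} → ‖x‖ ≤ ‖y‖} = {x : EuclideanSpace ℝ (Fin 3) | ‖x‖ ≤ ‖y‖} := by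
        ext x; simp only [mem_setOf_eq]; exact ⟨fun h => h hy, fun h _ => h⟩
      rw [this]
      exact isClosed_le continuous_norm continuous_const
    · have : {x : EuclideanSpace ℝ (Fin 3) | y ∈ {x : EuclideanSpace ℝ (Fin 3) | 1 ≤ x 0 ^ 2 + x 1 ^ 2 ∨ 2 ≤ x 2} → ‖x‖ ≤ ‖y‖} = univ := by
        ext x; simp only [mem_setOf_eq, mem_univ, iff_true]; exact fun h => absurd h hy
      rw [this]
      exact isClosed_univ
  · refine (Metric.isBounded_closedBall (x := (0 : EuclideanSpace ℝ (Fin 3))) (r := 1)).subset ?_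
    intro x hx
    rw [Metric.mem_closedBall, dist_zero_right, ← toy_norm_e0]
    exact hx.2 _ e0_mem_toyMin.1

/-- The axis point `(0,0,2)` is bad and fixed by EVERY rotation about the axis (`ρ_p < ∞`). -/
theorem a2_bad_and_fixed (θ : ℝ) : (WithLp.toLp 2 ![(0 : ℝ), 0, 2] : EuclideanSpace ℝ (Fin 3)) ∈ {x : EuclideanSpace ℝ (Fin 3) | 1 ≤ x 0 ^ 2 + x 1 ^ 2 ∨ 2 ≤ x 2} ∧
    (WithLp.toLp 2 ![Real.cos θ * (WithLp.toLp 2 ![(0 : ℝ), 0, 2] : EuclideanSpace ℝ (Fin 3)) 0 - Real.sin θ * (WithLp.toLp 2 ![(0 : ℝ), 0, 2] : EuclideanSpace ℝ (Fin 3)) 1, Real.sin θ * (WithLp.toLp 2 ![(0 : ℝ), 0, 2] : EuclideanSpace ℝ (Fin 3)) 0 + Real.cos θ * (WithLp.toLp 2 ![(0 : ℝ), 0, 2] : EuclideanSpace ℝ (Fin 3)) 1, (WithLp.toLp 2 ![(0 : ℝ), 0, 2] : EuclideanSpace ℝ (Fin 3)) 2] : EuclideanSpace ℝ (Fin 3))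 = (WithLp.toLp 2 ![(0 : ℝ), 0, 2] : EuclideanSpace ℝ (Fin 3)) := by
  refine ⟨Or.inr (by simp), ?_⟩
  ext i
  fin_cases i <;> simp

/-- A fixed point of the rotation by an angle with `cos θ ≠ 1` lies on the axis. -/
theorem onAxis_of_rot_fixed {θ : ℝ} (hθ : Real.cos θ ≠ 1) {x : EuclideanSpace ℝ (Fin 3)}
    (hx : (WithLp.toLp 2 ![Real.cos θ * x 0 - Real.sin θ * x 1, Real.sin θ * x 0 + Real.cos θ * x 1, x 2] : EuclideanSpace ℝ (Fin 3)) = x) :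
    x 0 = 0 ∧ x 1 = 0 := by
  have h0 : Real.cos θ * x 0 - Real.sin θ * x 1 = x 0 := by
    have := congrArg (fun z : EuclideanSpace ℝ (Fin 3) => z 0) hx
    simpa using this
  have h1 : Real.sin θ * x 0 + Real.cos θ * x 1 = x 1 := by
    have := congrArg (fun z : EuclideanSpace ℝ (Fin 3) => z 1) hx
    simpa using this
  have h3 := Real.cos_sq_add_sin_sq θ
  have hc : (2 : ℝ) - 2 * Real.cos θ ≠ 0 := fun h => hθ (by linarith)
  have k0 : (2 - 2 * Real.cos θ) * x 0 = 0 := by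
    linear_combination (Real.cos θ - 1) * h0 + Real.sin θ * h1 - (x 0) * h3
  have k1 : (2 - 2 * Real.cos θ) * x 1 = 0 := by
    linear_combination (Real.cos θ - 1) * h1 - Real.sin θ * h0 - (x 1) * h3
  exact ⟨(mul_eq_zero.1 k0).resolve_left hc, (mul_eq_zero.1 k1).resolve_left hc⟩

/-- For `p ≥ 2` the angle `2π/p ∈ (0, π]` is not a multiple of `2π`. -/
theorem cos_two_pi_div_ne_one {p : ℕ} (hp : 2 ≤ p) : Real.cos (2 * Real.pi / p) ≠ 1 := by
  have hp' : (0 : ℝ) < p := by exact_mod_cast (lt_of_lt_of_le (by norm_num) hp)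
  have hpos : 0 < 2 * Real.pi / p := div_pos (by positivity) hp'
  have hlt : 2 * Real.pi / p < 2 * Real.pi := by
    rw [div_lt_iff₀ hp']
    have : (2 : ℝ) ≤ p := by exact_mod_cast hp
    nlinarith [Real.pi_pos]
  intro h
  have := (Real.cos_eq_one_iff_of_lt_of_lt (by linarith [Real.pi_pos]) hlt).1 h
  linarith

/-- **The symmetric threshold of the toy is `2 > 1`** (abstract shadow of `stub_symmGapClosing`): a
bad point fixed by `R_{2π/p}`, `p ≥ 2`, has norm `≥ 2`, whereas `inf {‖x‖ : x bad} = 1`. -/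
theorem toy_symmetric_gap {p : ℕ} (hp : 2 ≤ p) {x : EuclideanSpace ℝ (Fin 3)} (hx : x ∈ {x : EuclideanSpace ℝ (Fin 3) | 1 ≤ x 0 ^ 2 + x 1 ^ 2 ∨ 2 ≤ x 2})
    (hfix : (WithLp.toLp 2 ![Real.cos (2 * Real.pi / p) * x 0 - Real.sin (2 * Real.pi / p) * x 1,
      Real.sin (2 * Real.pi / p) * x 0 + Real.cos (2 * Real.pi / p) * x 1, x 2] : EuclideanSpace ℝ (Fin 3)) = x) :
    (2 : ℝ) ≤ ‖x‖ := by
  obtain ⟨h0, h1⟩ := onAxis_of_rot_fixed (cos_two_pi_div_ne_one hp) hfix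
  simp only [mem_setOf_eq] at hx
  rcases hx with h | h
  · rw [h0, h1] at h
    norm_num at h
  · have h2 : |x 2| ≤ ‖x‖ := by
      have := PiLp.norm_apply_le x 2
      simpa using this
    exact le_trans (le_trans h (le_abs_self _)) h2

/-- **No minimiser of the toy is fixed by any `R_{2π/p}`, `p ≥ 2`.** -/
theorem no_symmetric_toyMinimiser {p : ℕ} (hp : 2 ≤ p) {x : EuclideanSpace ℝ (Fin 3)} (hx : x ∈ {x : EuclideanSpace ℝ (Fin 3) | x ∈ {x : EuclideanSpace ℝ (Fin 3) | 1 ≤ x 0 ^ 2 + x 1 ^ 2 ∨ 2 ≤ x 2} ∧ ∀ y ∈ {x : EuclideanSpace ℝ (Fin 3) | 1 ≤ x 0 ^ 2 + x 1 ^ 2 ∨ 2 ≤ x 2}, ‖x‖ ≤ ‖y‖})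
    (hfix : (WithLp.toLp 2 ![Real.cos (2 * Real.pi / p) * x 0 - Real.sin (2 * Real.pi / p) * x 1,
      Real.sin (2 * Real.pi / p) * x 0 + Real.cos (2 * Real.pi / p) * x 1, x 2] : EuclideanSpace ℝ (Fin 3)) = x) : False := by
  have hle : ‖x‖ ≤ 1 := by
    rw [← toy_norm_e0]
    exact hx.2 _ e0_mem_toyMin.1
  have hge := toy_symmetric_gap hp hx.1 hfix
  linarith

/-- **`not_abstractExtremality` — the natural strengthening of `MinimalDatumPFold` is FALSE.**
The abstract extremality principle "a closed, rotation-invariant bad set `B ⊆ EuclideanSpace ℝ (Fin 3)` whose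
norm-minimisers form a non-empty compact set and which has `R_{2π/p}`-fixed bad elements for every
`p ≥ 2` has an `R_{2π/p}`-fixed MINIMISER for unboundedly many `p`" fails for `B = {x : EuclideanSpace ℝ (Fin 3) | 1 ≤ x 0 ^ 2 + x 1 ^ 2 ∨ 2 ≤ x 2}`: non-emptiness
and compactness of the minimiser set, invariance and `ρ_p < ∞` do not produce symmetric minimisers —
the minimiser set here is a free `SO(2)`-orbit (χ = 0). [folklore] -/
theorem not_abstractExtremality :
    ¬ ∀ B : Set (EuclideanSpace ℝ (Fin 3)),
      (∀ (θ : ℝ) (x : EuclideanSpace ℝ (Fin 3)), x ∈ B →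
        (WithLp.toLp 2 ![Real.cos θ * x 0 - Real.sin θ * x 1, Real.sin θ * x 0 + Real.cos θ * x 1, x 2] : EuclideanSpace ℝ (Fin 3)) ∈ B) →
      IsClosed B →
      (∃ x, x ∈ B ∧ ∀ y ∈ B, ‖x‖ ≤ ‖y‖) →
      IsCompact {x : EuclideanSpace ℝ (Fin 3) | x ∈ B ∧ ∀ y ∈ B, ‖x‖ ≤ ‖y‖} →
      (∀ p : ℕ, 2 ≤ p → ∃ x, x ∈ B ∧
        (WithLp.toLp 2 ![Real.cos (2 * Real.pi / p) * x 0 - Real.sin (2 * Real.pi / p) * x 1,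
          Real.sin (2 * Real.pi / p) * x 0 + Real.cos (2 * Real.pi / p) * x 1, x 2] : EuclideanSpace ℝ (Fin 3)) = x) →
      ∀ N : ℕ, ∃ p : ℕ, N ≤ p ∧ 2 ≤ p ∧ ∃ x, (x ∈ B ∧ ∀ y ∈ B, ‖x‖ ≤ ‖y‖) ∧
        (WithLp.toLp 2 ![Real.cos (2 * Real.pi / p) * x 0 - Real.sin (2 * Real.pi / p) * x 1,
          Real.sin (2 * Real.pi / p) * x 0 + Real.cos (2 * Real.pi / p) * x 1, x 2] : EuclideanSpace ℝ (Fin 3)) = x := by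
  intro h
  obtain ⟨p, -, h2, x, hx, hfix⟩ := h {x : EuclideanSpace ℝ (Fin 3) | 1 ≤ x 0 ^ 2 + x 1 ^ 2 ∨ 2 ≤ x 2} (fun θ x hx => toyBad_rot θ x hx) isClosed_toyBad
    ⟨_, e0_mem_toyMin.1, e0_mem_toyMin.2⟩ isCompact_toyMin (fun p _ => ⟨_, a2_bad_and_fixed _⟩) 2
  exact no_symmetric_toyMinimiser h2 hx hfix

end Summit.NavierStokesRegularity.NavierStokesRegularity.Theorems.MinimalDatumPFold.Negative

end
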